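import Summits.QuantumFields.YangMills.Theorems.ParabolicTrajectoryLatticeGapOnTrajectorySlabClusteringOfDecayFar
import HarnessLib

/-!
# Crux `LatticeGapOnTrajectory` (stmt-QuantumFields-10523), line `sparse-defect-orbit-window`
# (`SketchIdeator5-r2`): stub `stub_slabClusteringOfDecay` — uniform slab clustering from the
# decay interface

`2 ≤ M → (∀ k, a_k = (M^{n_k})⁻¹) → TorusFramesExist → SpecificationTower → WilsonTorusDLR r →
CellDecayAlongP r M sch n → ∃ Δ > 0, Transfer.UniformSlabClustering r sch Δ`
(G-blind plumbing; a mechanical fork of the landed `stub_slabClustering`, p123095, whose proof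
touches the Dobrushin–Shlosman engine only at `SlabClustering.abs_corr_le_of_layers`): from the
engine-independent decay package along the scheme (`CellDecayAlongP`: scale `t`, radius `n₀`,
rate `κ`, constant `C₀`, resolution `α_k` with the polynomial clause `|β_k| α_k ≤ K₀ a_k^{−p₀}`;
the rough-centre bound is unused here), with `Δ = κ/t`, `p = 2(p₀ + 8)`,
`K = 4096 C₀ c₁² e^{4κ} + 2e^{3κ}` (`c₁ = 1 + 2e²|K₀|·7680 t⁴`), eventually in `k` (decay package at
`s = 0`, polynomial clause, `a_k ≤ 1`, `(2n₀+7) b_k ≤ L_k` for `b_k = t M^{n_k} = t/a_k`), for every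
bounded measurable slab observable `X` of lattice times `1 … w` on the torus of side `2L_k+1` and
`N + 2w ≤ L_k`:
`‖osCorr μ_k Θ₀ τ_N X X‖ ≤ K (a_k⁻¹ (w+1)(L_k+1))^p B² e^{−Δ a_k N}`.

* `SlabClusteringOfDecay.norm_osCorr_le_far_poly_of_decay`: the far case `3b ≤ N` in polynomial
  form (fork of `SlabClustering.norm_osCorr_le_far_poly`, calling `norm_osCorr_le_far_of_decay` of
  `…SlabClusteringOfDecayFar`): `(K+1)⁴ ≤ 16X⁴`, `δ ≤ 2Bc₁X^{p₀+4}`,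
  `e^{−κ(N/b−3)} ≤ e^{4κ}e^{−(κ/t)aN}`, `X = a⁻¹(w+1)(L+1)`.
* `stub_slabClusteringOfDecay` (registered): near case `N < 3b_k` by the imported
  `SlabClustering.norm_osCorr_le_near`, far case by the lemma above on the torus of side `2L_k + 1`
  with uniform frames of scale `b_k` (`K + 1 = (2L_k+1)/b_k ≥ 2n₀ + 3` cells per axis).

References: Dobrushin–Shlosman 1985; Föllmer 1988 Ch. I §2; Glimm–Jaffe 1987 §19.7.
-/

set_option autoImplicit false

noncomputable section

namespace Summit.QuantumFields.YangMills.Cruxes.LatticeGapOnTrajectory.SparseDefectOrbitWindow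

open scoped BigOperators Topology ENNReal ProbabilityTheory ComplexConjugate
open Filter MeasureTheory
open Literature.Probability.LatticeModels (Specification IsSpecification IsGibbsMeasure glueWith)
open Literature.MathematicalPhysics.QuantumLattice
open Literature.MathematicalPhysics.QuantumFieldTheory
open Summit.QuantumFields.YangMills.Theses.ParabolicTrajectory
open Summit.QuantumFields.YangMills.Cruxes.LatticeGapOnTrajectory.OrbitKantorovichFiniteSize
open Summit.QuantumFields.YangMills.Cruxes.LatticeGapOnTrajectory.OrbitKantorovichFiniteSize.SlabClustering

namespace SlabClusteringOfDecay

/-! ### Polynomial bookkeeping at one scale, through the decay interface -/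

section Scale

variable {G : Type} [Group G] [TopologicalSpace G] [IsTopologicalGroup G] [CompactSpace G]
  [MeasurableSpace G] [BorelSpace G] (r : LatticeRep G)

/-- **Far case in polynomial form, through the decay interface** (`3b ≤ N`, `b = t/a`, `a ≤ 1`,
`|β| α ≤ K₀ a^{−p₀}`): from `norm_osCorr_le_far_of_decay` with `(K+1)⁴ ≤ 16 X⁴`,
`δ ≤ 2B c₁ X^{p₀+4}` (`X = a⁻¹(w+1)(L+1) ≥ 1`, `c₁ = 1 + 2e²|K₀|·7680 t⁴`) and
`e^{−κ(N/b − 3)} ≤ e^{4κ} e^{−(κ/t) a N}`: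
`‖osCorr μ Θ₀ τ_N X X‖ ≤ 4096 C₀ c₁² e^{4κ} X^{2(p₀+8)} B² e^{−(κ/t) a N}`.
Fork of `SlabClustering.norm_osCorr_le_far_poly`. -/
theorem norm_osCorr_le_far_poly_of_decay (hT : SpecificationTower) {n₀ : ℕ} {κ C₀ : ℝ} (hκ : 0 ≤ κ)
    (hC₀ : 0 ≤ C₀) (β α : ℝ) (hα : 0 < α) {t p₀ : ℕ} {K₀ a : ℝ} (ht : 1 ≤ t) (ha0 : 0 < a)
    (ha1 : a ≤ 1) {Lk b K w Nsep : ℕ} (hbR : (b : ℝ) = t * a⁻¹) (hb : 0 < b)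
    (hK : K + 1 = (2 * Lk + 1) / b) (hbL : 4 * b ≤ Lk) (hNw : Nsep + 2 * w ≤ Lk) (hfar : 3 * b ≤ Nsep)
    (hn₀ : 2 * n₀ + 3 ≤ K + 1) (hγ : IsSpecification (torusYM r.ρ β (2 * Lk + 1)))
    (hGibbs : IsGibbsMeasure (torusYM r.ρ β (2 * Lk + 1)) (wilsonMeasure (d := 4) (L := 2 * Lk + 1) r.ρ β))
    (hdec : ∀ (μ : Fin 4 → ℕ) (q : (i : Fin 4) → ZMod (2 * Lk + 1) → ZMod (μ i + 1)),
        (∀ i, 2 * n₀ + 3 ≤ μ i + 1) → (∀ i, IsTorusFrame (2 * Lk + 1) b (q i)) →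
          CellDecay (cellOf q) (orbitWeight r α q)
            (wilsonMeasure (d := 4) (L := 2 * Lk + 1) r.ρ β) κ C₀)
    (hP : |β| * α ≤ K₀ * a⁻¹ ^ p₀)
    {X : GaugeConfig 4 (2 * Lk + 1) G → ℂ} {B : ℝ} (hXm : Measurable X) (hXb : ∀ U, ‖X U‖ ≤ B)
    (hXdep : DependsOn X {e : Edge 4 (2 * Lk + 1) | 1 ≤ (e.1 0).val ∧ (e.1 0).val ≤ w}) :
    ‖osCorr (wilsonMeasure (d := 4) (L := 2 * Lk + 1) r.ρ β) GaugeConfig.negReflect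
        (torusTimeShift (2 * Lk + 1) Nsep) X X‖ ≤
      4096 * C₀ * (1 + 2 * Real.exp 2 * |K₀| * (7680 * (t : ℝ) ^ 4)) ^ 2 * Real.exp (4 * κ) *
        (a⁻¹ * ((w : ℝ) + 1) * ((Lk : ℝ) + 1)) ^ ((p₀ + 8) * 2) * B ^ 2 *
          Real.exp (-(κ / t) * a * Nsep) := by
  -- adapted from `SlabClustering.norm_osCorr_le_far_poly` (…StubSlabClustering): `h1` now comes
  -- from the decay-interface far bound; the bookkeeping is unchanged
  have h1 := norm_osCorr_le_far_of_decay r hT hC₀ β α hα hb hK hbL hNw hfar hn₀ hγ hGibbs hdec hXm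
    hXb hXdep
  have ht0 : (0 : ℝ) < t := by exact_mod_cast ht
  have hb0R : (0 : ℝ) < b := by exact_mod_cast hb
  have hB : 0 ≤ B := (norm_nonneg _).trans (hXb fun _ => 1)
  -- the polynomial `X ≥ 1`
  obtain ⟨Xp, hXp⟩ : ∃ Xp : ℝ, Xp = a⁻¹ * ((w : ℝ) + 1) * ((Lk : ℝ) + 1) := ⟨_, rfl⟩
  obtain ⟨c₁, hc₁⟩ : ∃ c₁ : ℝ, c₁ = 1 + 2 * Real.exp 2 * |K₀| * (7680 * (t : ℝ) ^ 4) := ⟨_, rfl⟩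
  rw [← hXp, ← hc₁, pow_mul]
  have ha1' : 1 ≤ a⁻¹ := (one_le_inv₀ ha0).2 ha1
  have hw1 : (1 : ℝ) ≤ (w : ℝ) + 1 := by have := Nat.cast_nonneg (α := ℝ) w; linarith
  have hL1 : (1 : ℝ) ≤ (Lk : ℝ) + 1 := by have := Nat.cast_nonneg (α := ℝ) Lk; linarith
  have hXa : a⁻¹ ≤ Xp := by
    rw [hXp]
    calc a⁻¹ = a⁻¹ * 1 * 1 := by ring
      _ ≤ a⁻¹ * ((w : ℝ) + 1) * ((Lk : ℝ) + 1) := by gcongr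
  have hXL : (Lk : ℝ) + 1 ≤ Xp := by
    rw [hXp]
    calc (Lk : ℝ) + 1 = 1 * 1 * ((Lk : ℝ) + 1) := by ring
      _ ≤ a⁻¹ * ((w : ℝ) + 1) * ((Lk : ℝ) + 1) := by gcongr
  have hX1 : 1 ≤ Xp := ha1'.trans hXa
  -- `(K+1)⁴ ≤ 16 X⁴`
  have hK1 : ((K : ℝ) + 1) ≤ 2 * Xp := by
    have h3 : K + 1 ≤ 2 * Lk + 1 := by rw [hK]; exact Nat.div_le_self _ _
    have h4 : ((K : ℝ) + 1) ≤ 2 * Lk + 1 := by exact_mod_cast h3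
    linarith [hXL]
  have hK4 : ((K : ℝ) + 1) ^ 4 ≤ 16 * Xp ^ 4 := by
    calc ((K : ℝ) + 1) ^ 4 ≤ (2 * Xp) ^ 4 := pow_le_pow_left₀ (by positivity) hK1 4
      _ = 16 * Xp ^ 4 := by ring
  -- `δ ≤ 2B c₁ X^{p₀+4}`
  have hβα : |β| * α ≤ |K₀| * Xp ^ p₀ :=
    hP.trans ((mul_le_mul_of_nonneg_right (le_abs_self _) (by positivity)).trans
      (mul_le_mul_of_nonneg_left (pow_le_pow_left₀ (by positivity) hXa p₀) (abs_nonneg _)))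
  have hb4 : (b : ℝ) ^ 4 ≤ (t : ℝ) ^ 4 * Xp ^ 4 := by
    rw [hbR, mul_pow]
    gcongr
  have hδ : 2 * B * (1 + 2 * Real.exp 2 * |β| * α * (7680 * (b : ℝ) ^ 4)) ≤
      2 * B * c₁ * Xp ^ (p₀ + 4) := by
    have h3 : 2 * Real.exp 2 * |β| * α * (7680 * (b : ℝ) ^ 4) ≤
        2 * Real.exp 2 * (|K₀| * Xp ^ p₀) * (7680 * ((t : ℝ) ^ 4 * Xp ^ 4)) := by
      have h4 : 2 * Real.exp 2 * |β| * α * (7680 * (b : ℝ) ^ 4) =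
          2 * Real.exp 2 * (|β| * α) * (7680 * (b : ℝ) ^ 4) := by ring
      rw [h4]
      gcongr
    have hXpow : (1 : ℝ) ≤ Xp ^ (p₀ + 4) := one_le_pow₀ hX1
    have hpa : Xp ^ p₀ * Xp ^ 4 = Xp ^ (p₀ + 4) := (pow_add _ _ _).symm
    calc 2 * B * (1 + 2 * Real.exp 2 * |β| * α * (7680 * (b : ℝ) ^ 4))
        ≤ 2 * B * (1 + 2 * Real.exp 2 * (|K₀| * Xp ^ p₀) * (7680 * ((t : ℝ) ^ 4 * Xp ^ 4))) := by
          gcongr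
      _ = 2 * B * (1 + (2 * Real.exp 2 * |K₀| * (7680 * (t : ℝ) ^ 4)) * (Xp ^ p₀ * Xp ^ 4)) := by
          ring
      _ ≤ 2 * B * (Xp ^ (p₀ + 4) + (2 * Real.exp 2 * |K₀| * (7680 * (t : ℝ) ^ 4)) * Xp ^ (p₀ + 4)) := by
          rw [hpa]
          gcongr
      _ = 2 * B * c₁ * Xp ^ (p₀ + 4) := by rw [hc₁]; ring
  -- `A ≤ 32 c₁ B Y`, `Y = X^{p₀+8}`
  obtain ⟨Y, hY⟩ : ∃ Y : ℝ, Y = Xp ^ (p₀ + 8) := ⟨_, rfl⟩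
  rw [← hY]
  have hY0 : 0 ≤ Y := by rw [hY]; positivity
  have h48 : Xp ^ 4 * Xp ^ (p₀ + 4) = Y := by
    rw [hY, ← pow_add, show 4 + (p₀ + 4) = p₀ + 8 by omega]
  obtain ⟨A, hA⟩ : ∃ A : ℝ, A = ((K : ℝ) + 1) ^ 4 *
      (2 * B * (1 + 2 * Real.exp 2 * |β| * α * (7680 * (b : ℝ) ^ 4))) := ⟨_, rfl⟩
  obtain ⟨E, hE⟩ : ∃ E : ℝ, E = Real.exp (-(κ * ((Nsep / b - 3 : ℕ) : ℝ))) := ⟨_, rfl⟩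
  rw [← hA, ← hE] at h1
  have hA0 : 0 ≤ A := by rw [hA]; positivity
  have hAY : A ≤ 32 * c₁ * B * Y := by
    rw [hA]
    calc _ ≤ 16 * Xp ^ 4 * (2 * B * c₁ * Xp ^ (p₀ + 4)) := mul_le_mul hK4 hδ (by positivity) (by positivity)
      _ = 32 * c₁ * B * (Xp ^ 4 * Xp ^ (p₀ + 4)) := by ring
      _ = 32 * c₁ * B * Y := by rw [h48]
  -- `e^{−κ(N/b − 3)} ≤ e^{4κ} e^{−(κ/t) a N}`
  have hEE' : E ≤ Real.exp (4 * κ) * Real.exp (-(κ / t) * a * Nsep) := by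
    rw [hE, ← Real.exp_add, Real.exp_le_exp]
    have hD : (Nsep : ℝ) * a / t - 4 ≤ ((Nsep / b - 3 : ℕ) : ℝ) := by
      have h3 : (Nsep : ℝ) / b - 1 ≤ ((Nsep / b : ℕ) : ℝ) := by
        have h4 : Nsep < Nsep / b * b + b := Nat.lt_div_mul_add hb
        have h5 : (Nsep : ℝ) < ((Nsep / b : ℕ) : ℝ) * b + b := by exact_mod_cast h4
        rw [sub_le_iff_le_add, div_le_iff₀ hb0R]
        linarith
      have h6 : (3 : ℕ) ≤ Nsep / b := (Nat.le_div_iff_mul_le hb).2 hfar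
      have h7 : ((Nsep / b - 3 : ℕ) : ℝ) = ((Nsep / b : ℕ) : ℝ) - 3 := by
        rw [Nat.cast_sub h6]; norm_num
      have h8 : (Nsep : ℝ) / b = Nsep * a / t := by
        rw [hbR]; field_simp
      linarith
    have h9 := mul_le_mul_of_nonneg_left hD hκ
    have h10 : -(κ / t) * a * Nsep = -(κ * (Nsep * a / t)) := by ring
    rw [h10]
    linarith
  have step : C₀ * A ^ 2 * E ≤ C₀ * (32 * c₁ * B * Y) ^ 2 * (Real.exp (4 * κ) * Real.exp (-(κ / t) * a * Nsep)) :=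
    mul_le_mul (mul_le_mul_of_nonneg_left (pow_le_pow_left₀ hA0 hAY 2) hC₀) hEE'
      (by rw [hE]; positivity) (by positivity)
  calc _ ≤ 4 * (C₀ * A ^ 2 * E) := h1
    _ ≤ 4 * (C₀ * (32 * c₁ * B * Y) ^ 2 * (Real.exp (4 * κ) * Real.exp (-(κ / t) * a * Nsep))) := by
        linarith [step]
    _ = _ := by ring

end Scale

end SlabClusteringOfDecay

open SlabClusteringOfDecay in
/-- **stub_slabClusteringOfDecay** — UNIFORM SLAB CLUSTERING from the decay interface (G-blind; fork of the landed
`stub_slabClustering`, p123095, whose proof touches the engine only at `SlabClustering.abs_corr_le_of_layers`): the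
same inputs give cluster-expansion-format clustering of reflected slab autocorrelations on the scheme's own torus at
some rate `Δ > 0` (the polynomial resolution clause of `CellDecayAlongP` makes the TV-Lipschitz constants of Wilson's
slab kernels polynomial in the cutoff). With the decay package `(t, n₀, κ, C₀, α, K)` of `CellDecayAlongP`
(`RoughCentreBound` unused): `Δ = κ/t`, `p = 2(p₀ + 8)`, `K = 4096 C₀ c₁² e^{4κ} + 2e^{3κ}`
(`c₁ = 1 + 2e²|K₀|·7680 t⁴`), eventually in `k` (decay package at `s = 0`, polynomial clause, `a_k ≤ 1`,
`(2n₀+7) b_k ≤ L_k` for `b_k = t M^{n_k} = t/a_k`), for every bounded measurable slab observable `X` of lattice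
times `1 … w` on the torus of side `2L_k+1` and `N + 2w ≤ L_k`: near case `N < 3b_k` by
`SlabClustering.norm_osCorr_le_near`, far case by `norm_osCorr_le_far_poly_of_decay` on the torus of side
`2L_k + 1` with uniform frames of scale `b_k` (`K + 1 = (2L_k+1)/b_k ≥ 2n₀ + 3` cells per axis). -/
theorem stub_slabClusteringOfDecay :
    ∀ (G : Type) [Group G] [TopologicalSpace G] [IsTopologicalGroup G] [CompactSpace G]
      [MeasurableSpace G] [BorelSpace G] (r : LatticeRep G) (M : ℕ) (sch : SpeciesScheme (YMSpecies G))
      (n : ℕ → ℕ), 2 ≤ M → (∀ k, sch.a k = ((M : ℝ) ^ n k)⁻¹) →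
      TorusFramesExist → SpecificationTower → WilsonTorusDLR r → CellDecayAlongP r M sch n →
        ∃ Δ : ℝ, 0 < Δ ∧ Transfer.UniformSlabClustering r sch Δ := by
  -- adapted from `stub_slabClustering` (…StubSlabClustering): the window package + `KREngine` are
  -- replaced by the decay package `CellDecayAlongP`
  intro G _ _ _ _ _ _ r M sch n hM hshape _hTF hT hDLR hD
  obtain ⟨t, n₀, κ, C₀, α, Kf, ht, hκ, hC₀, hα, ⟨p₀, K₀, hP⟩, hDs⟩ := hD
  have ht0 : (0 : ℝ) < t := by exact_mod_cast ht
  refine ⟨κ / t, div_pos hκ ht0, (p₀ + 8) * 2,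
    4096 * C₀ * (1 + 2 * Real.exp 2 * |K₀| * (7680 * (t : ℝ) ^ 4)) ^ 2 * Real.exp (4 * κ) +
      2 * Real.exp (3 * κ), by positivity, ?_⟩
  have E1 : ∀ᶠ k in atTop, sch.a k ≤ 1 :=
    (sch.tendsto_a.eventually (gt_mem_nhds one_pos)).mono fun k hk => le_of_lt hk
  have E2 : ∀ᶠ k in atTop, (((2 * n₀ + 7) * t : ℕ) : ℝ) ≤ sch.a k * sch.L k :=
    sch.tendsto_L.eventually_ge_atTop _
  filter_upwards [hDs 0, hP, E1, E2] with k hk hPk ha1 hk2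
  intro w Nsep X B hXm hXb hXdep hNw
  -- the scales at step `k`
  have ha0 : 0 < sch.a k := sch.a_pos k
  have hMn : ((M : ℝ) ^ n k) = (sch.a k)⁻¹ := by rw [hshape k, inv_inv]
  have hbR : ((t * M ^ n k : ℕ) : ℝ) = t * (sch.a k)⁻¹ := by push_cast; rw [hMn]
  have hb0 : 0 < t * M ^ n k := Nat.mul_pos ht (Nat.pow_pos (by omega))
  have hL : (2 * n₀ + 7) * (t * M ^ n k) ≤ sch.L k := by
    have h1 : (((2 * n₀ + 7) * (t * M ^ n k) : ℕ) : ℝ) ≤ sch.L k := by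
      have h2 : (((2 * n₀ + 7) * t : ℕ) : ℝ) * (sch.a k)⁻¹ ≤ sch.L k := by
        rw [← div_eq_mul_inv, div_le_iff₀ ha0]
        simpa [mul_comm] using hk2
      have h3 : (((2 * n₀ + 7) * (t * M ^ n k) : ℕ) : ℝ) = (((2 * n₀ + 7) * t : ℕ) : ℝ) * (sch.a k)⁻¹ := by
        push_cast
        rw [hMn]
        ring
      rw [h3]
      exact h2
    exact_mod_cast h1
  have hbL : 4 * (t * M ^ n k) ≤ sch.L k := le_trans (Nat.mul_le_mul_right _ (by omega)) hL
  have hdiv : 1 ≤ (2 * sch.L k + 1) / (t * M ^ n k) := (Nat.le_div_iff_mul_le hb0).2 (by omega)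
  have hK : (2 * sch.L k + 1) / (t * M ^ n k) - 1 + 1 = (2 * sch.L k + 1) / (t * M ^ n k) := by omega
  have hn₀K : 2 * n₀ + 3 ≤ (2 * sch.L k + 1) / (t * M ^ n k) - 1 + 1 := by
    rw [hK, Nat.le_div_iff_mul_le hb0]
    nlinarith [hL]
  obtain ⟨hγ, hGibbs⟩ := hDLR (sch.β k) (2 * sch.L k + 1)
  have hdec : ∀ (μ : Fin 4 → ℕ) (q : (i : Fin 4) → ZMod (2 * sch.L k + 1) → ZMod (μ i + 1)),
      (∀ i, 2 * n₀ + 3 ≤ μ i + 1) → (∀ i, IsTorusFrame (2 * sch.L k + 1) (t * M ^ n k) (q i)) →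
        CellDecay (cellOf q) (orbitWeight r (α k) q)
          (wilsonMeasure (d := 4) (L := 2 * sch.L k + 1) r.ρ (sch.β k)) κ C₀ :=
    fun μ q hμ hq => (hk (sch.L k) le_rfl μ q hμ hq).1
  -- `X ≥ 1`
  have hX1 : 1 ≤ (sch.a k)⁻¹ * ((w : ℝ) + 1) * ((sch.L k : ℝ) + 1) := by
    have ha1' : 1 ≤ (sch.a k)⁻¹ := (one_le_inv₀ ha0).2 ha1
    have hw1 : (1 : ℝ) ≤ (w : ℝ) + 1 := by have := Nat.cast_nonneg (α := ℝ) w; linarith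
    have hL1 : (1 : ℝ) ≤ (sch.L k : ℝ) + 1 := by have := Nat.cast_nonneg (α := ℝ) (sch.L k); linarith
    calc (1 : ℝ) = 1 * 1 * 1 := by ring
      _ ≤ _ := by gcongr
  have hXp : 1 ≤ ((sch.a k)⁻¹ * ((w : ℝ) + 1) * ((sch.L k : ℝ) + 1)) ^ ((p₀ + 8) * 2) := one_le_pow₀ hX1
  have hc0 : 0 ≤ 4096 * C₀ * (1 + 2 * Real.exp 2 * |K₀| * (7680 * (t : ℝ) ^ 4)) ^ 2 * Real.exp (4 * κ) := by
    positivity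
  have hn0 : 0 ≤ Real.exp (3 * κ) := (Real.exp_pos _).le
  have hE0 : 0 ≤ B ^ 2 * Real.exp (-(κ / t) * sch.a k * Nsep) := by positivity
  -- near / far, then bookkeeping on opaque atoms
  rcases lt_or_ge Nsep (3 * (t * M ^ n k)) with hnear | hfar
  · have hb := norm_osCorr_le_near r (sch.β k) hκ.le ht0 ha0 hbR hnear hXb
    refine hb.trans ?_
    generalize ((sch.a k)⁻¹ * ((w : ℝ) + 1) * ((sch.L k : ℝ) + 1)) ^ ((p₀ + 8) * 2) = P at hXp ⊢
    generalize Real.exp (-(κ / t) * sch.a k * Nsep) = E at hE0 ⊢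
    generalize 4096 * C₀ * (1 + 2 * Real.exp 2 * |K₀| * (7680 * (t : ℝ) ^ 4)) ^ 2 * Real.exp (4 * κ) = Cf
      at hc0 ⊢
    generalize Real.exp (3 * κ) = Cn at hn0 ⊢
    nlinarith [mul_nonneg hc0 (mul_nonneg (zero_le_one.trans hXp) hE0),
      mul_nonneg hn0 (mul_nonneg (sub_nonneg.2 hXp) hE0)]
  · have hb := norm_osCorr_le_far_poly_of_decay r hT hκ.le hC₀ (sch.β k) (α k) (hα k) ht ha0 ha1 hbR
      hb0 hK hbL hNw hfar hn₀K hγ hGibbs hdec hPk hXm hXb hXdep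
    refine hb.trans ?_
    generalize ((sch.a k)⁻¹ * ((w : ℝ) + 1) * ((sch.L k : ℝ) + 1)) ^ ((p₀ + 8) * 2) = P at hXp ⊢
    generalize Real.exp (-(κ / t) * sch.a k * Nsep) = E at hE0 ⊢
    generalize 4096 * C₀ * (1 + 2 * Real.exp 2 * |K₀| * (7680 * (t : ℝ) ^ 4)) ^ 2 * Real.exp (4 * κ) = Cf
      at hc0 ⊢
    generalize Real.exp (3 * κ) = Cn at hn0 ⊢
    nlinarith [mul_nonneg hn0 (mul_nonneg (zero_le_one.trans hXp) hE0)]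

end Summit.QuantumFields.YangMills.Cruxes.LatticeGapOnTrajectory.SparseDefectOrbitWindow

end
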